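import Literature.NumberTheory.Automorphic.LocalUnitaryIntegralLevelCongr
import HarnessLib

/-!
# Level matching by a FORM CONGRUENCE at almost EVERY place (split places included): a similitude
# `T ∈ GL_N(E ⊗_F F_v)` with `ᵗ((c ⊗ 1) T) · J_v · T = a • Φ_N` whose conjugation `g ↦ T⁻¹ g T` carries `U(J)(𝒪_v)` onto `U(Φ_N)(𝒪_v)`
(Rogawski (1990), §14.2 p. 233 «for `v ∉ S₀ ∪ S`, `K_v ≃ K′_v`», (iii) «at split `v`, `G′_v ≅ D_w^* = GL_N(E_w) ≅ G_v`»;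
Platonov–Rapinchuk (1994), §2.3, §5.1; Tits (1979), §3.8)

Topic `NumberTheory/Automorphic`; namespace `Literature.NumberTheory.Automorphic.UnitaryGroup`.  THEOREMS ONLY (no definition, no
instance, no named fact, no notation, no `sorry`).  Sequel to ★ `LocalUnitaryIntegralLevelCongr` (level matching in the shape
`(cmDatumLocalCongr L v T ha h).symm` at almost every NON-SPLIT place, guard `∀ w ∣ v, c • w = w`) and ★ `LocalUnitaryGroupSimilitudeLevel`
(§2 there: `exists_glInt_formCongr_eq_of_split`, the COMPONENTWISE-INTEGRAL split-place similitude `T = (1, c⁻¹_*(J_w^{-ᵀ} Φ_w^{ᵀ}))`;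
§1 there: `localFormCongr_symm_mem_localIntegralLevel_iff`, integral similitudes match levels).  Cell `hodgecm-mathlib`, programme
R90-TF, section S9 «InnerForm-13.3.6 (c)», deal (R1-split) of R90-IF-plan (g2) 2026-09-05T00:15:03Z: the `hframe` binder of ★
`Summit.…R90.S9.….exists_level_gradePacket_eq_of_evpRep` (`Theorems/R90S9GermCofinalityOfLevels.lean`) — «COFINITELY in `v` there is a
LEVEL-MATCHING form congruence `(cmDatumLocalCongr L v T₁ ha h).symm : U(H)(L⁺_v) ≃ₜ* U(H′)(L⁺_v)`» at `H′ = Φ₃` — was ★ only under the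
non-split guard; this file removes the guard (socket `sock_S9_levelMatchingFrames_cm` of `Cruxes/H413/Lines/R90_S9_InnerFormTransportB.lean`).
`--supports stmt-HodgeConjecture-24833`; HC_CM is proved only modulo the printed citations until rung 0 closes.

## What is formalised (`E/F` CM-type quadratic, `c ≠ 1`, `J ∈ M_N(E)` `c`-hermitian, `Φ_N` the literal `Matrix.of fun i j => [i + j + 1 = N]`)
* §1 **`exists_localFormCongr_levelMatching_of_split`** — `w ∣ v` with `c • w ≠ w` (SPLIT `v`), `J` invertible with `J_{w'} ∈ GL_N(𝒪_{w'})`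
  for all `w' ∣ v`: there are `T ∈ GL_N(E_v)`, a unit `a` (`= 1`) and `h : ᵗ((c ⊗ 1) T) J_v T = a • (Φ_N)_v` with `T` componentwise
  integral and `(localFormCongr c v T ha h).symm g ∈ U(Φ_N)(𝒪_v) ↔ g ∈ U(J)(𝒪_v)` — the integral similitude ★ `exists_glInt_formCongr_eq_of_split`
  (`Φ_N` is hyperspecial everywhere, ★ `unit_placeForm_antidiagOne_mem_glInt`), levels by ★ `localFormCongr_symm_mem_localIntegralLevel_iff`;
  twin of the non-split ★ `exists_localFormCongr_levelMatching_of_smul_eq` in the same `∃ T a ha h` shape.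
* §2 **`eventually_exists_localFormCongr_levelMatching`** — the same at almost EVERY place of `F`, NO splitting guard (exceptions: `v`
  ramified in `E` or `J_w ∉ GL_N(𝒪_w)`, ★ `eventually_forall_unit_placeForm_mem_glInt`; non-split `v` by ★ `…_of_smul_eq`, split `v` by §1).
* §3 CM dress (`F = L⁺`, `E = L`, `c` = complex conjugation): **`eventually_exists_cmDatumLocalCongr_levelMatching_all (hH) (hHd) :
  ∀ᶠ v in cofinite, ∃ T a ha h, ∀ g, (cmDatumLocalCongr L v T ha h).symm g ∈ cmLocalIntegralLevel L N Φ_N v ↔ g ∈ cmLocalIntegralLevel L N H v`**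
  (no guard), `…_all'` with the componentwise integrality of `T` recorded, `…_all_three` the `N = 3` spelling with ★ `Rogawski1990.qsForm L`
  (token for token the `hframe` binder at `H′ := qsForm L`), and `…_all_three_of_anisotropic` (`det H ≠ 0` from anisotropy, ★
  `Godement.det_ne_zero_of_anisotropic`).

## Mathlib / tree search
Tree (★, by name): `LocalUnitaryGroupSimilitudeLevel` (`exists_glInt_formCongr_eq_of_split`, `localFormCongr_symm_mem_localIntegralLevel_iff`,
`exists_conj_levelMatching_of_ne` — the same mathematics with the similitude hidden behind `∃ ψ, ∃ S`), `LocalUnitaryIntegralLevelCongr`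
(`exists_localFormCongr_levelMatching_of_smul_eq`, `eventually_exists_cmDatumLocalCongr_levelMatching[_three]` — non-split guard),
`LocalUnitaryIntegralLevel` (`eventually_forall_unit_placeForm_mem_glInt`, `isUnit_placeForm_antidiagOne`, `unit_placeForm_antidiagOne_mem_glInt`,
`antidiagOne_map_transpose`), `LocalUnitaryGroupCongr` (`localFormCongr`, `cmDatumLocalCongr`, `antidiagOne_eq_over`, `map_cmConjRingHom_eq_map_complexConj`),
`UnitaryGroupSplitPlace` (`isUnit_placeForm`).  `lean search 'levelMatching_of_split|levelMatching_all'`: nothing.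

## References
* [Rogawski1990] J. Rogawski, *Automorphic Representations of Unitary Groups in Three Variables*, Ann. of Math. Stud. 123 (1990), §14.2 p. 233.
* [PlatonovRapinchuk1994] V. Platonov, A. Rapinchuk, *Algebraic Groups and Number Theory* (1994), §2.3, §5.1.
* [Tits1979] J. Tits, *Reductive groups over local fields*, PSPM 33.1 (1979), §3.8.
-/

set_option autoImplicit false

noncomputable section

open NumberField IsDedekindDomain Filter
open scoped Matrix MatrixGroups

namespace Literature.NumberTheory.Automorphic

namespace UnitaryGroup

section Generic

variable {F E : Type} [Field F] [NumberField F] [Field E] [NumberField E] [Algebra F E]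
  [Algebra.IsQuadraticExtension F E] (c : E ≃ₐ[F] E) {N : ℕ} {J : Matrix (Fin N) (Fin N) E} {v : HeightOneSpectrum (𝓞 F)}

/-! ## §1 Level matching by a form congruence at a good SPLIT place -/

/-- **LEVEL MATCHING BY A FORM CONGRUENCE at a good split place.**  `c ≠ 1`, `J` `c`-hermitian and invertible, `w ∣ v` with `c • w ≠ w`
(so `E_v = E_w × E_{c⁻¹ w}`), `J_{w'} ∈ GL_N(𝒪_{w'})` for all `w' ∣ v`: the similitude `T = (1, c⁻¹_*(J_w^{-ᵀ} Φ_w^{ᵀ})) ∈ GL_N(E_v)` of ★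
`exists_glInt_formCongr_eq_of_split` is componentwise integral and satisfies `ᵗ((c ⊗ 1) T) · J_v · T = 1 • (Φ_N)_v`, so `g ↦ T⁻¹ g T`
(★ `localFormCongr … .symm`) carries `U(J)(𝒪_v)` onto `U(Φ_N)(𝒪_v)` (both are `GL_N(𝒪_w)` read in the `w`-component).
[cite: Rogawski1990, §14.2 p. 233] [cite: PlatonovRapinchuk1994, §5.1] [cite: Tits1979, §3.8] -/
theorem exists_localFormCongr_levelMatching_of_split (hc : c ≠ 1) (hJh : (J.map c)ᵀ = J) (hJu : IsUnit J) (w : PlacesOver E v)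
    (hw : c • w.1 ≠ w.1) (hint : ∀ w' : PlacesOver E v, (isUnit_placeForm J hJu w'.1).unit ∈ glInt N (w'.1.adicCompletion E)) :
    ∃ (T : GL (Fin N) (LocalRing E v)) (a : LocalRing E v) (ha : IsUnit a)
      (h : formCongr (conjLocal E c v) T (J.map (algebraMap E (LocalRing E v))) =
        a • (Matrix.of fun i j : Fin N => if i.val + j.val + 1 = N then (1 : E) else 0).map (algebraMap E (LocalRing E v))),
      (∀ w' : PlacesOver E v, localGLPiEquiv E N v T w' ∈ glInt N (w'.1.adicCompletion E)) ∧
      ∀ g : «local» E c N J v,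
        (localFormCongr c v T ha h).symm g ∈
            localIntegralLevel c N (Matrix.of fun i j : Fin N => if i.val + j.val + 1 = N then (1 : E) else 0) v ↔
          g ∈ localIntegralLevel c N J v := by
  -- `Φ_N` is invertible and hyperspecial at every place above `v`
  have hΦu : IsUnit (Matrix.of fun i j : Fin N => if i.val + j.val + 1 = N then (1 : E) else 0) := by
    rw [antidiagOne_eq_over]; exact StdForm.isUnit_over _ E
  have hintΦ : ∀ w' : PlacesOver E v, (isUnit_placeForm _ hΦu w'.1).unit ∈ glInt N (w'.1.adicCompletion E) := by
    intro w'
    have he : (isUnit_placeForm _ hΦu w'.1).unit = (isUnit_placeForm_antidiagOne (E := E) N w'.1).unit :=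
      Units.ext ((IsUnit.unit_spec _).trans (IsUnit.unit_spec _).symm)
    rw [he]; exact unit_placeForm_antidiagOne_mem_glInt N w'.1
  -- the componentwise-integral split similitude onto `Φ_N`
  obtain ⟨T, hTint, hT⟩ := exists_glInt_formCongr_eq_of_split c hc hJh (antidiagOne_map_transpose c N) hJu hΦu w hw hint hintΦ
  have h1 : formCongr (conjLocal E c v) T (J.map (algebraMap E (LocalRing E v))) =
      (1 : LocalRing E v) • (Matrix.of fun i j : Fin N => if i.val + j.val + 1 = N then (1 : E) else 0).map
        (algebraMap E (LocalRing E v)) := by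
    rw [hT, one_smul]
  exact ⟨T, 1, isUnit_one, h1, hTint, fun g => localFormCongr_symm_mem_localIntegralLevel_iff c v T isUnit_one h1 hTint g⟩

/-! ## §2 Level matching by a form congruence at almost EVERY place (no splitting guard) -/

omit [Algebra.IsQuadraticExtension F E] in
/-- Only finitely many places of `F` ramify in `E` (prime factors of the different; private copy of the tree's
`finite_setOf_not_isUnramifiedIn`, as in ★ `LocalUnitaryIntegralLevelCongr`). [folklore] -/
private theorem finite_setOf_not_isUnramifiedIn_all :
    {v : HeightOneSpectrum (𝓞 F) | ¬ Algebra.IsUnramifiedIn (𝓞 E) v.asIdeal}.Finite := by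
  have hD : differentIdeal (𝓞 F) (𝓞 E) ≠ ⊥ := differentIdeal_ne_bot
  have hfin : {Q : HeightOneSpectrum (𝓞 E) | Q.asIdeal ∣ differentIdeal (𝓞 F) (𝓞 E)}.Finite := Ideal.finite_factors hD
  refine (hfin.image fun Q => Q.under (𝓞 F)).subset ?_
  intro q hq
  simp only [Set.mem_setOf_eq, Algebra.IsUnramifiedIn, not_forall] at hq
  obtain ⟨Q, hQprime, hQover, hQunr⟩ := hq
  haveI := hQprime
  have hQne : Q ≠ ⊥ := Ideal.ne_bot_of_liesOver_of_ne_bot q.ne_bot Q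
  refine ⟨⟨Q, hQprime, hQne⟩, ?_, ?_⟩
  · exact dvd_differentIdeal_iff.mpr hQunr
  · exact HeightOneSpectrum.ext hQover.over.symm

/-- **Level matching by a form congruence at almost EVERY place** (`c ≠ 1`, `J` `c`-hermitian, `det J` a unit): for all `v` outside a
finite set (the places ramified in `E` and those with some `J_w ∉ GL_N(𝒪_w)`, `w ∣ v`) there are a similitude `T ∈ GL_N(E_v)` onto `a • Φ_N`,
componentwise integral, with `T⁻¹ g T ∈ U(Φ_N)(𝒪_v) ↔ g ∈ U(J)(𝒪_v)` — non-split `v`: the integral hyperbolic basis (★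
`exists_localFormCongr_levelMatching_of_smul_eq`); split `v`: §1.  No splitting guard. [cite: Rogawski1990, §14.2 p. 233]
[cite: PlatonovRapinchuk1994, §5.1] -/
theorem eventually_exists_localFormCongr_levelMatching (hc : c ≠ 1) (hJh : (J.map c)ᵀ = J) (hJd : IsUnit J.det) :
    ∀ᶠ v : HeightOneSpectrum (𝓞 F) in cofinite,
      ∃ (T : GL (Fin N) (LocalRing E v)) (a : LocalRing E v) (ha : IsUnit a)
        (h : formCongr (conjLocal E c v) T (J.map (algebraMap E (LocalRing E v))) =
          a • (Matrix.of fun i j : Fin N => if i.val + j.val + 1 = N then (1 : E) else 0).map (algebraMap E (LocalRing E v))),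
        (∀ w' : PlacesOver E v, localGLPiEquiv E N v T w' ∈ glInt N (w'.1.adicCompletion E)) ∧
        ∀ g : «local» E c N J v,
          (localFormCongr c v T ha h).symm g ∈
              localIntegralLevel c N (Matrix.of fun i j : Fin N => if i.val + j.val + 1 = N then (1 : E) else 0) v ↔
            g ∈ localIntegralLevel c N J v := by
  have hJu : IsUnit J := (Matrix.isUnit_iff_isUnit_det J).2 hJd
  filter_upwards [eventually_forall_unit_placeForm_mem_glInt (F := F) N J hJu,
    (finite_setOf_not_isUnramifiedIn_all (F := F) (E := E)).compl_mem_cofinite] with v hint hunr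
  have hv : Algebra.IsUnramifiedIn (𝓞 E) v.asIdeal := not_not.1 hunr
  obtain ⟨w⟩ := (inferInstance : Nonempty (PlacesOver E v))
  by_cases hw : c • w.1 = w.1
  · exact exists_localFormCongr_levelMatching_of_smul_eq c hc hJh w hw hv (isUnit_placeForm J hJu w.1) (hint w)
  · exact exists_localFormCongr_levelMatching_of_split c hc hJh hJu w hw hint

end Generic

/-! ## §3 The CM dress: `(cmDatumLocalCongr L v T ha h).symm` matches `U(H)(𝒪_v)` with `U(Φ_N)(𝒪_v)` at almost EVERY place -/

section CM

variable (L : Type) [Field L] [NumberField L] [IsCMField L] (N : ℕ) (H : Matrix (Fin N) (Fin N) L)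

/-- **LEVEL-MATCHING FORM CONGRUENCE AT ALMOST EVERY PLACE, CM dress, NO splitting guard** — the `hframe` binder of the R90-TF S9 germ
cofinality (★ `exists_level_gradePacket_eq_of_evpRep`) at `H′ = Φ_N`: for `H` hermitian (`ᵗH̄ = H`) with `det H` a unit, for all but
finitely many finite places `v` of `L⁺` there are `T ∈ GL_N(L ⊗ L⁺_v)`, a unit `a` and `h : ᵗT̄ · H_v · T = a • (Φ_N)_v` such that
`(cmDatumLocalCongr L v T ha h).symm : U(H)(L⁺_v) ≃ₜ* U(Φ_N)(L⁺_v)` satisfies `ψ g ∈ U(Φ_N)(𝒪_v) ↔ g ∈ U(H)(𝒪_v)`.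
[cite: Rogawski1990, §14.2 p. 233] [cite: PlatonovRapinchuk1994, §5.1] -/
theorem eventually_exists_cmDatumLocalCongr_levelMatching_all (hH : (H.map (cmConjRingHom L))ᵀ = H) (hHd : IsUnit H.det) :
    ∀ᶠ v : HeightOneSpectrum (𝓞 ↥(maximalRealSubfield L)) in cofinite,
      ∃ (T : GL (Fin N) (LocalRing L v)) (a : LocalRing L v) (ha : IsUnit a)
        (h : formCongr (conjLocal L (IsCMField.complexConj L) v) T (H.map (algebraMap L (LocalRing L v))) =
          a • (Matrix.of fun i j : Fin N => if i.val + j.val + 1 = N then (1 : L) else 0).map (algebraMap L (LocalRing L v))),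
        ∀ g : (cmDatum L N H).Local v,
          (cmDatumLocalCongr L v T ha h).symm g ∈
              cmLocalIntegralLevel L N (Matrix.of fun i j : Fin N => if i.val + j.val + 1 = N then (1 : L) else 0) v ↔
            g ∈ cmLocalIntegralLevel L N H v := by
  filter_upwards [eventually_exists_localFormCongr_levelMatching (IsCMField.complexConj L) (IsCMField.complexConj_ne_one L)
    ((map_cmConjRingHom_eq_map_complexConj L H) ▸ hH) hHd] with v hv
  obtain ⟨T, a, ha, h, -, hlev⟩ := hv
  exact ⟨T, a, ha, h, hlev⟩

/-- The same with the componentwise integrality of `T` recorded (`T_w ∈ GL_N(𝒪_w)` for every `w ∣ v`). [cite: Rogawski1990, §14.2 p. 233] -/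
theorem eventually_exists_cmDatumLocalCongr_levelMatching_all' (hH : (H.map (cmConjRingHom L))ᵀ = H) (hHd : IsUnit H.det) :
    ∀ᶠ v : HeightOneSpectrum (𝓞 ↥(maximalRealSubfield L)) in cofinite,
      ∃ (T : GL (Fin N) (LocalRing L v)) (a : LocalRing L v) (ha : IsUnit a)
        (h : formCongr (conjLocal L (IsCMField.complexConj L) v) T (H.map (algebraMap L (LocalRing L v))) =
          a • (Matrix.of fun i j : Fin N => if i.val + j.val + 1 = N then (1 : L) else 0).map (algebraMap L (LocalRing L v))),
        (∀ w : PlacesOver L v, localGLPiEquiv L N v T w ∈ glInt N (w.1.adicCompletion L)) ∧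
        ∀ g : (cmDatum L N H).Local v,
          (cmDatumLocalCongr L v T ha h).symm g ∈
              cmLocalIntegralLevel L N (Matrix.of fun i j : Fin N => if i.val + j.val + 1 = N then (1 : L) else 0) v ↔
            g ∈ cmLocalIntegralLevel L N H v := by
  filter_upwards [eventually_exists_localFormCongr_levelMatching (IsCMField.complexConj L) (IsCMField.complexConj_ne_one L)
    ((map_cmConjRingHom_eq_map_complexConj L H) ▸ hH) hHd] with v hv
  exact hv

/-- **`N = 3`, spelled with ★ `Rogawski1990.qsForm L`** — token for token the `hframe` binder of ★ `exists_level_gradePacket_eq_of_evpRep` ∕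
`hgermLevel_gammaSph` at `H′ := qsForm L` (`qsForm` is an `abbrev` of the literal, so this is the previous theorem at `N = 3` by `rfl`).
[cite: Rogawski1990, §14.2 p. 233] -/
theorem eventually_exists_cmDatumLocalCongr_levelMatching_all_three (H₃ : Matrix (Fin 3) (Fin 3) L)
    (hH : (H₃.map (cmConjRingHom L))ᵀ = H₃) (hHd : IsUnit H₃.det) :
    ∀ᶠ v : HeightOneSpectrum (𝓞 ↥(maximalRealSubfield L)) in cofinite,
      ∃ (T : GL (Fin 3) (LocalRing L v)) (a : LocalRing L v) (ha : IsUnit a)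
        (h : formCongr (conjLocal L (IsCMField.complexConj L) v) T (H₃.map (algebraMap L (LocalRing L v))) =
          a • (Rogawski1990.qsForm L).map (algebraMap L (LocalRing L v))),
        ∀ g : (cmDatum L 3 H₃).Local v,
          (cmDatumLocalCongr L v T ha h).symm g ∈ cmLocalIntegralLevel L 3 (Rogawski1990.qsForm L) v ↔
            g ∈ cmLocalIntegralLevel L 3 H₃ v :=
  eventually_exists_cmDatumLocalCongr_levelMatching_all L 3 H₃ hH hHd

/-- The same for an ANISOTROPIC hermitian `H₃` (`det H₃ ≠ 0` by ★ `Godement.det_ne_zero_of_anisotropic`) — the hypotheses the S9 datum holds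
(`hanis`, `hherm`). [cite: Rogawski1990, §14.2 p. 233] -/
theorem eventually_exists_cmDatumLocalCongr_levelMatching_all_three_of_anisotropic (H₃ : Matrix (Fin 3) (Fin 3) L)
    (hanis : ∀ x : Fin 3 → L, Literature.AlgebraicGeometry.ShimuraVarieties.hermForm (cmConjRingHom L) H₃ x x = 0 → x = 0)
    (hH : (H₃.map (cmConjRingHom L))ᵀ = H₃) :
    ∀ᶠ v : HeightOneSpectrum (𝓞 ↥(maximalRealSubfield L)) in cofinite,
      ∃ (T : GL (Fin 3) (LocalRing L v)) (a : LocalRing L v) (ha : IsUnit a)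
        (h : formCongr (conjLocal L (IsCMField.complexConj L) v) T (H₃.map (algebraMap L (LocalRing L v))) =
          a • (Rogawski1990.qsForm L).map (algebraMap L (LocalRing L v))),
        ∀ g : (cmDatum L 3 H₃).Local v,
          (cmDatumLocalCongr L v T ha h).symm g ∈ cmLocalIntegralLevel L 3 (Rogawski1990.qsForm L) v ↔
            g ∈ cmLocalIntegralLevel L 3 H₃ v :=
  eventually_exists_cmDatumLocalCongr_levelMatching_all L 3 H₃ hH
    (isUnit_iff_ne_zero.2 (Godement.det_ne_zero_of_anisotropic L H₃ hanis))

end CM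

end UnitaryGroup

end Literature.NumberTheory.Automorphic

end
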